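import Literature.NumberTheory.LFunctions.HalaszEulerProduct
import Mathlib.NumberTheory.LSeries.Linearity
import HarnessLib

/-!
# Halász's theorem for block-restricted sums, I: the Euler-product side

Let `g : ℕ → ℂ` be completely multiplicative with `|g| ≤ 1`, `g̃` its `(N+1)`-smooth truncation
(`Halasz.smoothCut`), and let `blk i` (`i ∈ 𝓙`) be finitely many pairwise disjoint finite sets of primes
`≤ N` ("blocks"; in Matomäki–Radziwiłł these are the primes of the intervals `[P_j, Q_j]`).  Put
`E = ⋃ blk i` and let `𝒮 = {n : n has a prime factor in every block}`.  This file studies the Dirichlet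
series of the RESTRICTED function `a = g̃ · 1_𝒮` (which is not multiplicative):

* `blockInd_eq_sum` — inclusion–exclusion `1_𝒮 = ∑_{t ⊆ 𝓙} (-1)^{|t|} 1_{(n, E_t) = 1}`,
  `E_t = ⋃_{i ∈ t} blk i` (Matomäki–Radziwiłł 2016, Lemma 5);
* `LSeries_restr_eq` — the FACTORISATION, for `Re s > 0`:
  `∑ a(n) n^{-s} = G_∁(s) · ∏_{i ∈ 𝓙} (G_i(s) - 1)`, where `G_i(s) = ∏_{p ∈ blk i} (1 - g(p)p^{-s})⁻¹` and
  `G_∁` is the Euler product over the primes `≤ N` outside `E` (each sifted function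
  `g̃ 1_{(n,E_t)=1}` is completely multiplicative with Euler product `G_∁ ∏_{i ∉ t} G_i`, and
  `∑_t (-1)^{|t|} ∏_{i ∉ t} G_i = ∏_i (G_i - 1)`);
* `norm_exp_sub_one_le_exp_half` — the elementary inequality `|e^z - 1| ≤ e^{(K + Re z)/2}` for
  `|z| ≤ K` (from `2 cosh a - 2 cos b ≤ e^{|a|} - 1 + b² ≤ e^K - 1` on `a² + b² ≤ K²`), whence
  `|G_i(s) - 1| ≤ exp((K_i + Re z_i)/2 + 2ε_i)` with `z_i = ∑_{p ∈ blk i} g(p)p^{-s}`,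
  `K_i = ∑_{p ∈ blk i} p^{-Re s}`, `ε_i = ∑_{p ∈ blk i} p^{-2}` (`norm_blockEuler_sub_one_le`): the block
  `blk i` contributes to `log |G_i - 1|` at most `K_i - D_i/2`, i.e. HALF of its pretentious distance
  `D_i = K_i - Re z_i` is retained, with no loss of a factor `2` per block;
* `norm_LSeries_restr_le` — for `Re s ≥ 1`,
  `|∑ a(n) n^{-s}| ≤ exp(3 + ∑_{p ∉ E} Re(g(p)p^{-s}) + ∑_{p ∈ E} (p^{-Re s} + Re(g(p)p^{-s}))/2)`;
  on the `1`-line this is `≤ e⁷ log x · exp(-𝔻_½(g, n^{iy}; x)²)` with the HALVED distance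
  `𝔻_½² = ∑_{p ≤ x} w_p (1 - Re g(p)p^{-iy})/p`, `w_p = 1/2` on `E` and `1` off `E`
  (`halfDistSq`, `norm_LSeries_restr_one_line_le`), and on `Re s = 1 + α` it is
  `≤ e^{12} min(log x, 1/α)` (`norm_LSeries_restr_le_min`);
* `halfDistSq_ge_half` — `𝔻_½² ≥ 𝔻²/2`, and the `ℓ¹` majorants of `a`.

These feed the Granville–Soundararajan proof of Halász's theorem (tree files `HalaszMeanSquare`,
`HalaszIntegration`) in `HalaszRestrictedMeanSquare.lean` / `HalaszRestricted.lean`, giving Halász's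
theorem for `∑_{n ≤ x, n ∈ 𝒮} g(n)` with the distance `min_t 𝔻_½²` and NO `2^{|𝓙|}` loss — the
tool by which the complex Matomäki–Radziwiłł theorem (Matomäki–Radziwiłł–Tao 2015, Appendix A) is
proved in this library.  (Matomäki–Radziwiłł, *Multiplicative functions in short intervals II*,
arXiv:2007.04290, Remark after Theorem 9.2, obtain the restricted main term only in the weaker form
`2^J M e^{-M/2}` by inclusion–exclusion and Halász for each sifted function.)

## References
* A. Granville, K. Soundararajan, *Decay of mean values of multiplicative functions*, Canad. J.
  Math. 55 (2003), §§3–4 (the method). [cite: GranvilleSoundararajan2003, §3]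
* K. Matomäki, M. Radziwiłł, Ann. of Math. 183 (2016), Lemma 5 (inclusion–exclusion over blocks).
* K. Matomäki, M. Radziwiłł, arXiv:2007.04290, Remark after Theorem 9.2.
-/

noncomputable section

open Finset Real Complex
open scoped ComplexConjugate

namespace Literature.NumberTheory.LFunctions

namespace Halasz

namespace Restricted

variable {ι : Type*}

/-! ### Blocks, the restriction `1_𝒮` and the sifted indicators -/

/-- `n ∈ 𝒮`: `n` has a prime factor in every block `blk i`, `i ∈ 𝓙`. [cite: MatomakiRadziwillAnnals2016, §2 (the set 𝒮)] -/
def MemBlocks (𝓙 : Finset ι) (blk : ι → Finset ℕ) (n : ℕ) : Prop := ∀ i ∈ 𝓙, ∃ p ∈ blk i, p ∣ n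

open scoped Classical in
/-- The indicator `1_𝒮(n) ∈ {0, 1} ⊂ ℂ`. [folklore] -/
def blockInd (𝓙 : Finset ι) (blk : ι → Finset ℕ) (n : ℕ) : ℂ := if MemBlocks 𝓙 blk n then 1 else 0

open scoped Classical in
/-- The indicator of `(n, P) = 1` ("no `p ∈ P` divides `n`"), in `ℂ`. [folklore] -/
def copInd (P : Finset ℕ) (n : ℕ) : ℂ := if ∀ p ∈ P, ¬ p ∣ n then 1 else 0

/-- The sifted function `g · 1_{(n,P)=1}`. [folklore] -/
def sieveOut (P : Finset ℕ) (g : ℕ → ℂ) : ℕ → ℂ := fun n => g n * copInd P n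

/-- The restricted function `a = g̃ · 1_𝒮`. [folklore] -/
def restr (𝓙 : Finset ι) (blk : ι → Finset ℕ) (g : ℕ → ℂ) (N : ℕ) : ℕ → ℂ :=
  fun n => smoothCut g N n * blockInd 𝓙 blk n

variable {𝓙 : Finset ι} {blk : ι → Finset ℕ} {g : ℕ → ℂ} {N : ℕ}

/-- `1_𝒮` takes the values `0, 1`; in particular `‖1_𝒮(n)‖ ≤ 1`. [folklore] -/
theorem norm_blockInd_le (𝓙 : Finset ι) (blk : ι → Finset ℕ) (n : ℕ) : ‖blockInd 𝓙 blk n‖ ≤ 1 := by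
  unfold blockInd; split_ifs <;> simp

/-- `‖1_{(n,P)=1}‖ ≤ 1`. [folklore] -/
theorem norm_copInd_le (P : Finset ℕ) (n : ℕ) : ‖copInd P n‖ ≤ 1 := by
  unfold copInd; split_ifs <;> simp

/-- `‖a(n)‖ ≤ ‖g̃(n)‖`. [folklore] -/
theorem norm_restr_le_smoothCut (n : ℕ) : ‖restr 𝓙 blk g N n‖ ≤ ‖smoothCut g N n‖ := by
  unfold restr
  rw [norm_mul]
  exact mul_le_of_le_one_right (norm_nonneg _) (norm_blockInd_le 𝓙 blk n)

/-- `‖a(n)‖ ≤ 1` for `1`-bounded `g`. [folklore] -/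
theorem norm_restr_le_one (hgb : ∀ n, ‖g n‖ ≤ 1) (n : ℕ) : ‖restr 𝓙 blk g N n‖ ≤ 1 :=
  (norm_restr_le_smoothCut n).trans (norm_smoothCut_le hgb n)

/-- `‖(g 1_{(·,P)=1})(n)‖ ≤ 1` for `1`-bounded `g`. [folklore] -/
theorem norm_sieveOut_le (hgb : ∀ n, ‖g n‖ ≤ 1) (P : Finset ℕ) (n : ℕ) : ‖sieveOut P g n‖ ≤ 1 := by
  unfold sieveOut
  rw [norm_mul]
  calc ‖g n‖ * ‖copInd P n‖ ≤ 1 * 1 := by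
        gcongr
        · exact hgb n
        · exact norm_copInd_le P n
    _ = 1 := one_mul 1

/-- `a(0) = 0`. [folklore] -/
theorem restr_zero : restr 𝓙 blk g N 0 = 0 := by simp [restr, smoothCut_zero]

/-- `1` is coprime to every `P`: `1_{(1,P)=1} = 1` when `P` consists of primes. [folklore] -/
theorem copInd_one {P : Finset ℕ} (hP : ∀ p ∈ P, p.Prime) : copInd P 1 = 1 := by
  unfold copInd
  rw [if_pos]
  intro p hp h
  exact (hP p hp).one_lt.ne' (Nat.dvd_one.mp h)

/-- The sifted indicator is completely multiplicative when `P` consists of primes. [folklore] -/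
theorem copInd_mul {P : Finset ℕ} (hP : ∀ p ∈ P, p.Prime) (m n : ℕ) :
    copInd P (m * n) = copInd P m * copInd P n := by
  unfold copInd
  by_cases hm : ∀ p ∈ P, ¬ p ∣ m
  · by_cases hn : ∀ p ∈ P, ¬ p ∣ n
    · have hmn : ∀ p ∈ P, ¬ p ∣ m * n := fun p hp h =>
        ((hP p hp).dvd_mul.mp h).elim (hm p hp) (hn p hp)
      rw [if_pos hm, if_pos hn, if_pos hmn, one_mul]
    · have hmn : ¬ ∀ p ∈ P, ¬ p ∣ m * n := by
        intro h; apply hn; intro p hp hpn; exact h p hp (Dvd.dvd.mul_left hpn m)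
      rw [if_neg hmn, if_neg hn, mul_zero]
  · have hmn : ¬ ∀ p ∈ P, ¬ p ∣ m * n := by
      intro h; apply hm; intro p hp hpm; exact h p hp (Dvd.dvd.mul_right hpm n)
    rw [if_neg hmn, if_neg hm, zero_mul]

/-- `sieveOut P g` is completely multiplicative when `g` is and `P` consists of primes. [folklore] -/
theorem sieveOut_mul {P : Finset ℕ} (hP : ∀ p ∈ P, p.Prime) (hg : ∀ m n, g (m * n) = g m * g n)
    (m n : ℕ) : sieveOut P g (m * n) = sieveOut P g m * sieveOut P g n := by
  unfold sieveOut
  rw [hg, copInd_mul hP]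
  ring

/-- `(sieveOut P g)(1) = 1` when `g(1) = 1`. [folklore] -/
theorem sieveOut_one {P : Finset ℕ} (hP : ∀ p ∈ P, p.Prime) (hg1 : g 1 = 1) : sieveOut P g 1 = 1 := by
  simp [sieveOut, hg1, copInd_one hP]

/-- At a prime `p`: `1_{(p,P)=1} = 1` if `p ∉ P` and `= 0` if `p ∈ P` (`P` a set of primes). [folklore] -/
theorem copInd_prime {P : Finset ℕ} (hP : ∀ p ∈ P, p.Prime) {p : ℕ} (hp : p.Prime) :
    copInd P p = if p ∈ P then 0 else 1 := by
  unfold copInd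
  by_cases h : p ∈ P
  · rw [if_pos h, if_neg]
    intro h'
    exact h' p h dvd_rfl
  · rw [if_neg h, if_pos]
    intro q hq hqp
    have : q = p := (Nat.prime_dvd_prime_iff_eq (hP q hq) hp).mp hqp
    exact h (this ▸ hq)

/-! ### Inclusion–exclusion: `1_𝒮 = ∑_{t ⊆ 𝓙} (-1)^{|t|} 1_{(n, E_t) = 1}` -/

/-- `1_𝒮(n) = ∏_{i ∈ 𝓙} (1 - 1_{(n, blk i) = 1})`. [folklore] -/
theorem blockInd_eq_prod (𝓙 : Finset ι) (blk : ι → Finset ℕ) (n : ℕ) :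
    blockInd 𝓙 blk n = ∏ i ∈ 𝓙, (1 - copInd (blk i) n) := by
  classical
  unfold blockInd
  by_cases h : MemBlocks 𝓙 blk n
  · rw [if_pos h]
    symm
    refine Finset.prod_eq_one fun i hi => ?_
    obtain ⟨p, hp, hpn⟩ := h i hi
    unfold copInd
    rw [if_neg, sub_zero]
    intro h'
    exact h' p hp hpn
  · rw [if_neg h]
    symm
    unfold MemBlocks at h
    push Not at h
    obtain ⟨i, hi, hnone⟩ := h
    refine Finset.prod_eq_zero hi ?_
    unfold copInd
    rw [if_pos (fun p hp => hnone p hp), sub_self]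

/-- `∏_{i ∈ t} 1_{(n, blk i)=1} = 1_{(n, E_t)=1}`, `E_t = ⋃_{i ∈ t} blk i`. [folklore] -/
theorem prod_copInd_eq [DecidableEq ι] (t : Finset ι) (blk : ι → Finset ℕ) (n : ℕ) :
    ∏ i ∈ t, copInd (blk i) n = copInd (t.biUnion blk) n := by
  classical
  unfold copInd
  rw [Finset.prod_boole]
  by_cases h : ∀ i ∈ t, ∀ p ∈ blk i, ¬ p ∣ n
  · rw [if_pos h, if_pos]
    intro p hp
    rw [Finset.mem_biUnion] at hp
    obtain ⟨i, hi, hpi⟩ := hp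
    exact h i hi p hpi
  · rw [if_neg h, if_neg]
    intro h'
    apply h
    intro i hi p hp
    exact h' p (Finset.mem_biUnion.mpr ⟨i, hi, hp⟩)

/-- **Inclusion–exclusion over the blocks** (Matomäki–Radziwiłł 2016, Lemma 5):
`1_𝒮(n) = ∑_{t ⊆ 𝓙} (-1)^{|t|} 1_{(n, E_t) = 1}`. [cite: MatomakiRadziwillAnnals2016, Lemma 5] -/
theorem blockInd_eq_sum [DecidableEq ι] (𝓙 : Finset ι) (blk : ι → Finset ℕ) (n : ℕ) :
    blockInd 𝓙 blk n = ∑ t ∈ 𝓙.powerset, (-1) ^ t.card * copInd (t.biUnion blk) n := by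
  rw [blockInd_eq_prod]
  have h : ∀ i ∈ 𝓙, (1 - copInd (blk i) n) = (-copInd (blk i) n) + 1 := fun i _ => by ring
  rw [Finset.prod_congr rfl h, Finset.prod_add]
  refine Finset.sum_congr rfl fun t _ => ?_
  rw [Finset.prod_const_one, mul_one, Finset.prod_neg, prod_copInd_eq]

/-- The restricted function as a signed sum of sifted, completely multiplicative functions:
`a(n) = ∑_{t ⊆ 𝓙} (-1)^{|t|} (g̃ 1_{(·,E_t)=1})(n)`. [folklore] -/
theorem restr_eq_sum [DecidableEq ι] (n : ℕ) :
    restr 𝓙 blk g N n = ∑ t ∈ 𝓙.powerset, (-1) ^ t.card * smoothCut (sieveOut (t.biUnion blk) g) N n := by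
  unfold restr
  rw [blockInd_eq_sum, Finset.mul_sum]
  refine Finset.sum_congr rfl fun t _ => ?_
  have hsc : smoothCut (sieveOut (t.biUnion blk) g) N n = smoothCut g N n * copInd (t.biUnion blk) n := by
    by_cases hn : n ∈ Nat.smoothNumbers (N + 1)
    · rw [smoothCut_of_mem hn, smoothCut_of_mem hn]; rfl
    · rw [smoothCut_of_not_mem hn, smoothCut_of_not_mem hn, zero_mul]
  rw [hsc]
  ring

/-! ### Euler products of the sifted functions and the factorisation of `∑ a(n) n^{-s}` -/

/-- The Euler factor of a block or of a set of primes: `G_P(s) = ∏_{p ∈ P} (1 - g(p) p^{-s})⁻¹`. [folklore] -/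
def blockEuler (g : ℕ → ℂ) (P : Finset ℕ) (s : ℂ) : ℂ := ∏ p ∈ P, (1 - g p * (p : ℂ) ^ (-s))⁻¹

/-- **Euler product of a sifted function**: for `P ⊆` primes and `Re s > 0`,
`∑ (g̃ 1_{(·,P)=1})(n) n^{-s} = ∏_{p ≤ N, p ∉ P} (1 - g(p)p^{-s})⁻¹`. [folklore] -/
theorem LSeries_sieveOut_eq (hg : ∀ m n, g (m * n) = g m * g n) (hg1 : g 1 = 1)
    (hgb : ∀ n, ‖g n‖ ≤ 1) {P : Finset ℕ} (hP : ∀ p ∈ P, p.Prime) {s : ℂ} (hs : 0 < s.re) :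
    LSeriesSummable (smoothCut (sieveOut P g) N) s ∧
      LSeries (smoothCut (sieveOut P g) N) s = blockEuler g (Nat.primesBelow (N + 1) \ P) s := by
  have hmul := sieveOut_mul hP hg
  have h1 := sieveOut_one (g := g) hP hg1
  have hb := norm_sieveOut_le hgb P
  refine ⟨LSeriesSummable_smoothCut hmul h1 hb hs, ?_⟩
  rw [LSeries_smoothCut_eq_prod hmul h1 hb hs, blockEuler]
  rw [← Finset.prod_sdiff (Finset.sdiff_subset (s := Nat.primesBelow (N + 1)) (t := P))]
  have hin : ∀ p ∈ Nat.primesBelow (N + 1) \ (Nat.primesBelow (N + 1) \ P),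
      (1 - sieveOut P g p * (p : ℂ) ^ (-s))⁻¹ = 1 := by
    intro p hp
    simp only [Finset.mem_sdiff, Nat.mem_primesBelow, not_and, not_not] at hp
    have hpP : p ∈ P := hp.2 hp.1
    unfold sieveOut
    rw [copInd_prime hP hp.1.2, if_pos hpP]
    simp
  have hout : ∀ p ∈ Nat.primesBelow (N + 1) \ P,
      (1 - sieveOut P g p * (p : ℂ) ^ (-s))⁻¹ = (1 - g p * (p : ℂ) ^ (-s))⁻¹ := by
    intro p hp
    simp only [Finset.mem_sdiff, Nat.mem_primesBelow] at hp
    unfold sieveOut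
    rw [copInd_prime hP hp.1.2, if_neg hp.2, mul_one]
  rw [Finset.prod_congr rfl hin, Finset.prod_const_one, one_mul, Finset.prod_congr rfl hout]

/-- A **block system**: finitely many pairwise disjoint blocks of primes `≤ N`. [cite: MatomakiRadziwillAnnals2016, §2] -/
structure IsBlockSystem (𝓙 : Finset ι) (blk : ι → Finset ℕ) (N : ℕ) : Prop where
  subset : ∀ i ∈ 𝓙, blk i ⊆ Nat.primesBelow (N + 1)
  disjoint : ∀ i ∈ 𝓙, ∀ j ∈ 𝓙, i ≠ j → Disjoint (blk i) (blk j)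

namespace IsBlockSystem

/-- Every element of a block is a prime `≤ N`. [folklore] -/
theorem prime_of_mem (h : IsBlockSystem 𝓙 blk N) {i : ι} (hi : i ∈ 𝓙) {p : ℕ} (hp : p ∈ blk i) : p.Prime :=
  (Nat.mem_primesBelow.mp (h.subset i hi hp)).2

/-- The union `E_t` of some blocks consists of primes. [folklore] -/
theorem prime_of_mem_biUnion [DecidableEq ι] (h : IsBlockSystem 𝓙 blk N) {t : Finset ι} (ht : t ⊆ 𝓙) {p : ℕ}
    (hp : p ∈ t.biUnion blk) : p.Prime := by
  rw [Finset.mem_biUnion] at hp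
  obtain ⟨i, hi, hpi⟩ := hp
  exact h.prime_of_mem (ht hi) hpi

/-- `E_t ⊆` primes `≤ N`. [folklore] -/
theorem biUnion_subset [DecidableEq ι] (h : IsBlockSystem 𝓙 blk N) {t : Finset ι} (ht : t ⊆ 𝓙) :
    t.biUnion blk ⊆ Nat.primesBelow (N + 1) := by
  intro p hp
  rw [Finset.mem_biUnion] at hp
  obtain ⟨i, hi, hpi⟩ := hp
  exact h.subset i (ht hi) hpi

/-- A sub-family of a block system is a block system. [folklore] -/
theorem mono (h : IsBlockSystem 𝓙 blk N) {𝓙' : Finset ι} (h' : 𝓙' ⊆ 𝓙) : IsBlockSystem 𝓙' blk N :=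
  ⟨fun i hi => h.subset i (h' hi), fun i hi j hj hij => h.disjoint i (h' hi) j (h' hj) hij⟩

/-- Removing the blocks of `t ⊆ 𝓙` from the primes `≤ N` leaves the primes outside `E = E_𝓙`
together with the blocks of `𝓙 \ t`, disjointly. [folklore] -/
theorem sdiff_biUnion_eq [DecidableEq ι] (h : IsBlockSystem 𝓙 blk N) {t : Finset ι} (ht : t ⊆ 𝓙) :
    Nat.primesBelow (N + 1) \ t.biUnion blk =
      (Nat.primesBelow (N + 1) \ 𝓙.biUnion blk) ∪ (𝓙 \ t).biUnion blk := by
  ext p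
  simp only [Finset.mem_sdiff, Finset.mem_union, Finset.mem_biUnion, not_exists, not_and]
  constructor
  · rintro ⟨hpN, hnot⟩
    by_cases hE : ∃ i ∈ 𝓙, p ∈ blk i
    · obtain ⟨i, hi, hpi⟩ := hE
      refine Or.inr ⟨i, ⟨hi, fun hit => hnot i hit hpi⟩, hpi⟩
    · push Not at hE
      exact Or.inl ⟨hpN, hE⟩
  · rintro (⟨hpN, hnot⟩ | ⟨i, ⟨hi, hit⟩, hpi⟩)
    · exact ⟨hpN, fun i hi hpi => hnot i (ht hi) hpi⟩
    · refine ⟨h.subset i hi hpi, fun j hj hpj => ?_⟩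
      have hij : i ≠ j := fun e => hit (e ▸ hj)
      exact Finset.disjoint_left.mp (h.disjoint i hi j (ht hj) hij) hpi hpj

/-- The two pieces of `sdiff_biUnion_eq` are disjoint. [folklore] -/
theorem _root_.Literature.NumberTheory.LFunctions.Halasz.Restricted.disjoint_sdiff_biUnion [DecidableEq ι]
    (𝓙 : Finset ι) (blk : ι → Finset ℕ) (N : ℕ) (t : Finset ι) :
    Disjoint (Nat.primesBelow (N + 1) \ 𝓙.biUnion blk) ((𝓙 \ t).biUnion blk) := by
  refine Finset.disjoint_left.mpr fun p hp hp' => ?_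
  rw [Finset.mem_sdiff] at hp
  rw [Finset.mem_biUnion] at hp'
  obtain ⟨i, hi, hpi⟩ := hp'
  exact hp.2 (Finset.mem_biUnion.mpr ⟨i, (Finset.mem_sdiff.mp hi).1, hpi⟩)

/-- The Euler product over the primes outside `E_t` factors as `G_∁ · ∏_{i ∈ 𝓙 \ t} G_i`. [folklore] -/
theorem blockEuler_sdiff_eq [DecidableEq ι] (h : IsBlockSystem 𝓙 blk N) {t : Finset ι} (ht : t ⊆ 𝓙) (s : ℂ) :
    blockEuler g (Nat.primesBelow (N + 1) \ t.biUnion blk) s =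
      blockEuler g (Nat.primesBelow (N + 1) \ 𝓙.biUnion blk) s * ∏ i ∈ 𝓙 \ t, blockEuler g (blk i) s := by
  unfold blockEuler
  rw [h.sdiff_biUnion_eq ht, Finset.prod_union (disjoint_sdiff_biUnion 𝓙 blk N t),
    Finset.prod_biUnion]
  intro i hi j hj hij
  exact h.disjoint i (Finset.mem_sdiff.mp hi).1 j (Finset.mem_sdiff.mp hj).1 hij

end IsBlockSystem

/-- `∑_{t ⊆ 𝓙} (-1)^{|t|} ∏_{i ∈ 𝓙 \ t} u_i = ∏_{i ∈ 𝓙} (u_i - 1)`. [folklore] -/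
theorem sum_neg_one_pow_mul_prod_sdiff [DecidableEq ι] (𝓙 : Finset ι) (u : ι → ℂ) :
    ∑ t ∈ 𝓙.powerset, (-1) ^ t.card * ∏ i ∈ 𝓙 \ t, u i = ∏ i ∈ 𝓙, (u i - 1) := by
  have h : ∀ i ∈ 𝓙, (u i - 1) = (-1) + u i := fun i _ => by ring
  rw [Finset.prod_congr rfl h, Finset.prod_add]
  refine Finset.sum_congr rfl fun t _ => ?_
  rw [Finset.prod_const]

/-- **Factorisation of the restricted Dirichlet series**: for a block system and `Re s > 0`,
`∑ a(n) n^{-s} = G_∁(s) ∏_{i ∈ 𝓙} (G_i(s) - 1)`, `a = g̃ 1_𝒮`, together with the absolute convergence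
of the series. [folklore] -/
theorem LSeries_restr_eq [DecidableEq ι] (h : IsBlockSystem 𝓙 blk N)
    (hg : ∀ m n, g (m * n) = g m * g n) (hg1 : g 1 = 1) (hgb : ∀ n, ‖g n‖ ≤ 1) {s : ℂ}
    (hs : 0 < s.re) :
    LSeriesSummable (restr 𝓙 blk g N) s ∧
      LSeries (restr 𝓙 blk g N) s =
        blockEuler g (Nat.primesBelow (N + 1) \ 𝓙.biUnion blk) s * ∏ i ∈ 𝓙, (blockEuler g (blk i) s - 1) := by
  -- the restricted function as a finite sum of sifted functions
  set f : Finset ι → ℕ → ℂ := fun t n => (-1) ^ t.card * smoothCut (sieveOut (t.biUnion blk) g) N n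
    with hf
  have hfun : restr 𝓙 blk g N = ∑ t ∈ 𝓙.powerset, f t := by
    funext n
    rw [Finset.sum_apply]
    exact restr_eq_sum n
  have hpieces : ∀ t ∈ 𝓙.powerset, LSeriesSummable (f t) s ∧
      LSeries (f t) s = (-1) ^ t.card * blockEuler g (Nat.primesBelow (N + 1) \ t.biUnion blk) s := by
    intro t ht
    have ht' : t ⊆ 𝓙 := Finset.mem_powerset.mp ht
    obtain ⟨hsum, heq⟩ := LSeries_sieveOut_eq (N := N) hg hg1 hgb
      (P := t.biUnion blk) (fun p hp => h.prime_of_mem_biUnion ht' hp) hs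
    have hfsmul : f t = ((-1 : ℂ) ^ t.card) • smoothCut (sieveOut (t.biUnion blk) g) N := by
      funext n; simp [hf]
    refine ⟨?_, ?_⟩
    · rw [hfsmul]; exact hsum.smul _
    · rw [hfsmul, LSeries_smul, heq]
  refine ⟨?_, ?_⟩
  · rw [hfun]
    exact LSeriesSummable.sum fun t ht => (hpieces t ht).1
  · rw [hfun, LSeries_sum fun t ht => (hpieces t ht).1]
    rw [Finset.sum_congr rfl fun t ht => (hpieces t ht).2]
    have hfac : ∀ t ∈ 𝓙.powerset, (-1 : ℂ) ^ t.card * blockEuler g (Nat.primesBelow (N + 1) \ t.biUnion blk) s =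
        blockEuler g (Nat.primesBelow (N + 1) \ 𝓙.biUnion blk) s *
          ((-1) ^ t.card * ∏ i ∈ 𝓙 \ t, blockEuler g (blk i) s) := by
      intro t ht
      rw [h.blockEuler_sdiff_eq (Finset.mem_powerset.mp ht)]
      ring
    rw [Finset.sum_congr rfl hfac, ← Finset.mul_sum, sum_neg_one_pow_mul_prod_sdiff]

/-! ### The inequality `|e^z - 1| ≤ e^{(K + Re z)/2}` for `|z| ≤ K` -/

/-- `t ↦ e^t - t²` is monotone (its derivative `e^t - 2t` is positive). [folklore] -/
theorem exp_sub_sq_mono {a b : ℝ} (hab : a ≤ b) :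
    Real.exp a - a ^ 2 ≤ Real.exp b - b ^ 2 := by
  -- `φ(t) = e^t - t²` has `φ(b) - φ(a) = ∫_a^b (e^t - 2t) dt ≥ 0`
  have key : ∀ t : ℝ, 0 ≤ Real.exp t - 2 * t := by
    intro t
    have := Real.add_one_le_exp (t - 1)
    have h3 : Real.exp (t - 1) * Real.exp 1 = Real.exp t := by rw [← Real.exp_add]; ring_nf
    have he1 : 2 ≤ Real.exp 1 := by have := Real.exp_one_gt_d9; linarith
    nlinarith [Real.exp_pos (t - 1)]
  -- integrate the derivative
  have hderiv : ∀ t ∈ Set.uIcc a b, HasDerivAt (fun t => Real.exp t - t ^ 2) (Real.exp t - 2 * t) t := by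
    intro t _
    have h1 : HasDerivAt (fun t : ℝ => t ^ 2) (2 * t) t := by simpa using hasDerivAt_pow 2 t
    exact (Real.hasDerivAt_exp t).sub h1
  have hint : IntervalIntegrable (fun t => Real.exp t - 2 * t) MeasureTheory.volume a b :=
    (by fun_prop : Continuous fun t => Real.exp t - 2 * t).intervalIntegrable _ _
  have hftc := intervalIntegral.integral_eq_sub_of_hasDerivAt hderiv hint
  have hpos : 0 ≤ ∫ t in a..b, (Real.exp t - 2 * t) :=
    intervalIntegral.integral_nonneg hab fun t _ => key t
  linarith

/-- **The key inequality**: for `‖z‖ ≤ K`, `‖e^z - 1‖ ≤ exp((K + Re z)/2)`.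
Proof: with `z = a + ib`, `‖e^z - 1‖² = e^a (2 cosh a - 2 cos b)` and
`2 cosh a - 2 cos b ≤ e^{|a|} + 1 - 2 + b² ≤ e^{|a|} - 1 + K² - a² ≤ e^K - 1 < e^K`
(`cos b ≥ 1 - b²/2`, `t ↦ e^t - t²` increasing). [folklore] -/
theorem norm_exp_sub_one_le_exp_half {z : ℂ} {K : ℝ} (hz : ‖z‖ ≤ K) :
    ‖Complex.exp z - 1‖ ≤ Real.exp ((K + z.re) / 2) := by
  have hK0 : 0 ≤ K := (norm_nonneg z).trans hz
  set a : ℝ := z.re with ha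
  set b : ℝ := z.im with hb
  have habs : |a| ≤ K := (Complex.abs_re_le_norm z).trans hz
  have hab2 : a ^ 2 + b ^ 2 ≤ K ^ 2 := by
    have h1 : ‖z‖ ^ 2 = a ^ 2 + b ^ 2 := by
      rw [Complex.sq_norm, Complex.normSq_apply]; ring
    rw [← h1]
    exact pow_le_pow_left₀ (norm_nonneg z) hz 2
  -- `‖e^z - 1‖² = e^{2a} - 2 e^a cos b + 1`
  have hsq : ‖Complex.exp z - 1‖ ^ 2 = Real.exp a * (Real.exp a + Real.exp (-a) - 2 * Real.cos b) := by
    rw [Complex.sq_norm, Complex.normSq_apply]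
    simp only [Complex.sub_re, Complex.exp_re, Complex.one_re, Complex.sub_im, Complex.exp_im,
      Complex.one_im, sub_zero]
    have hcs : Real.cos z.im ^ 2 + Real.sin z.im ^ 2 = 1 := Real.cos_sq_add_sin_sq z.im
    have hee : Real.exp z.re * Real.exp (-z.re) = 1 := by rw [← Real.exp_add]; simp
    simp only [ha, hb]
    linear_combination (Real.exp z.re) ^ 2 * hcs - hee
  -- `e^a + e^{-a} - 2 cos b ≤ e^K - 1`
  have hcos : 1 - b ^ 2 / 2 ≤ Real.cos b := Real.one_sub_sq_div_two_le_cos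
  have hexpneg : Real.exp (-|a|) ≤ 1 := by
    rw [Real.exp_le_one_iff]; exact neg_nonpos.mpr (abs_nonneg a)
  have hcosh : Real.exp a + Real.exp (-a) = Real.exp |a| + Real.exp (-|a|) := by
    rcases le_or_gt 0 a with h | h
    · rw [abs_of_nonneg h]
    · rw [abs_of_neg h, neg_neg, add_comm]
  have hmono := exp_sub_sq_mono habs
  have hsqa : |a| ^ 2 = a ^ 2 := sq_abs a
  have hmain : Real.exp a + Real.exp (-a) - 2 * Real.cos b ≤ Real.exp K - 1 := by
    rw [hcosh]
    nlinarith
  -- conclude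
  have hlhs : ‖Complex.exp z - 1‖ ^ 2 ≤ Real.exp ((K + a) / 2) ^ 2 := by
    rw [hsq, ← Real.exp_nat_mul]
    have : ((2 : ℕ) : ℝ) * ((K + a) / 2) = K + a := by push_cast; ring
    rw [this, Real.exp_add]
    have hea : 0 < Real.exp a := Real.exp_pos a
    calc Real.exp a * (Real.exp a + Real.exp (-a) - 2 * Real.cos b) ≤ Real.exp a * (Real.exp K - 1) := by
          gcongr
      _ ≤ Real.exp a * Real.exp K := by gcongr; linarith
      _ = Real.exp K * Real.exp a := mul_comm _ _
  exact (pow_le_pow_iff_left₀ (norm_nonneg _) (Real.exp_pos _).le two_ne_zero).mp hlhs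

/-- A perturbed form: for `‖z‖ ≤ K` and `‖r‖ ≤ 1`,
`‖e^{z + r} - 1‖ ≤ exp((K + Re z)/2 + 2‖r‖)`. [folklore] -/
theorem norm_exp_add_sub_one_le {z r : ℂ} {K : ℝ} (hz : ‖z‖ ≤ K) (hr : ‖r‖ ≤ 1) :
    ‖Complex.exp (z + r) - 1‖ ≤ Real.exp ((K + z.re) / 2 + 2 * ‖r‖) := by
  have hre : z.re ≤ K := (Complex.re_le_norm z).trans hz
  have h1 : Complex.exp (z + r) - 1 = Complex.exp z * (Complex.exp r - 1) + (Complex.exp z - 1) := by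
    rw [Complex.exp_add]; ring
  have h2 : ‖Complex.exp z‖ ≤ Real.exp ((K + z.re) / 2) := by
    rw [Complex.norm_exp]
    exact Real.exp_le_exp.mpr (by linarith)
  have h3 : ‖Complex.exp r - 1‖ ≤ 2 * ‖r‖ := Complex.norm_exp_sub_one_le hr
  have h4 := norm_exp_sub_one_le_exp_half hz
  have hE : 0 < Real.exp ((K + z.re) / 2) := Real.exp_pos _
  calc ‖Complex.exp (z + r) - 1‖ ≤ ‖Complex.exp z * (Complex.exp r - 1)‖ + ‖Complex.exp z - 1‖ := by
        rw [h1]; exact norm_add_le _ _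
    _ ≤ Real.exp ((K + z.re) / 2) * (2 * ‖r‖) + Real.exp ((K + z.re) / 2) := by
        rw [norm_mul]
        gcongr
    _ = Real.exp ((K + z.re) / 2) * (2 * ‖r‖ + 1) := by ring
    _ ≤ Real.exp ((K + z.re) / 2) * Real.exp (2 * ‖r‖) := by
        gcongr
        linarith [Real.add_one_le_exp (2 * ‖r‖)]
    _ = Real.exp ((K + z.re) / 2 + 2 * ‖r‖) := by rw [← Real.exp_add]

/-! ### Bounding the block Euler factors -/

/-- `‖g(p) p^{-s}‖ ≤ p^{-Re s} ≤ 1/2` for a prime `p` and `Re s ≥ 1`. [folklore] -/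
theorem norm_term_le_rpow (hgb : ∀ n, ‖g n‖ ≤ 1) {p : ℕ} (hp : p.Prime) (s : ℂ) :
    ‖g p * (p : ℂ) ^ (-s)‖ ≤ (p : ℝ) ^ (-s.re) := by
  rw [norm_mul, Complex.norm_natCast_cpow_of_pos hp.pos, Complex.neg_re]
  calc ‖g p‖ * (p : ℝ) ^ (-s.re) ≤ 1 * (p : ℝ) ^ (-s.re) := by gcongr; exact hgb p
    _ = _ := one_mul _

/-- For `Re s ≥ 1`: `p^{-Re s} ≤ 1/p ≤ 1/2`. [folklore] -/
theorem rpow_neg_re_le {p : ℕ} (hp : p.Prime) {s : ℂ} (hs : 1 ≤ s.re) :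
    (p : ℝ) ^ (-s.re) ≤ 1 / p := by
  have h1 : (p : ℝ) ^ (-s.re) ≤ (p : ℝ) ^ (-1 : ℝ) :=
    Real.rpow_le_rpow_of_exponent_le (by exact_mod_cast hp.one_lt.le) (by linarith)
  rwa [Real.rpow_neg_one, ← one_div] at h1

/-- **Norm of a sub-Euler-product**: for a set `P` of primes `≤ N` and `Re s ≥ 1`,
`‖∏_{p ∈ P} (1 - g(p)p^{-s})⁻¹‖ ≤ exp(∑_{p ∈ P} Re(g(p)p^{-s}) + 1)`. [folklore] -/
theorem norm_blockEuler_le (hgb : ∀ n, ‖g n‖ ≤ 1) {P : Finset ℕ} (hP : P ⊆ Nat.primesBelow (N + 1))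
    {s : ℂ} (hs : 1 ≤ s.re) :
    ‖blockEuler g P s‖ ≤ Real.exp (∑ p ∈ P, (g p * (p : ℂ) ^ (-s)).re + 1) := by
  unfold blockEuler
  rw [norm_prod]
  have hprime : ∀ p ∈ P, p.Prime := fun p hp => (Nat.mem_primesBelow.mp (hP hp)).2
  have hz : ∀ p ∈ P, ‖g p * (p : ℂ) ^ (-s)‖ ≤ 1 / p := fun p hp =>
    (norm_term_le_rpow hgb (hprime p hp) s).trans (rpow_neg_re_le (hprime p hp) hs)
  have hz' : ∀ p ∈ P, ‖g p * (p : ℂ) ^ (-s)‖ ≤ 1 / 2 := fun p hp =>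
    (hz p hp).trans (one_div_le_one_div_of_le (by norm_num) (by exact_mod_cast (hprime p hp).two_le))
  calc ∏ p ∈ P, ‖(1 - g p * (p : ℂ) ^ (-s))⁻¹‖
      ≤ ∏ p ∈ P, Real.exp ((g p * (p : ℂ) ^ (-s)).re + ‖g p * (p : ℂ) ^ (-s)‖ ^ 2) :=
        Finset.prod_le_prod (fun p _ => norm_nonneg _) fun p hp => norm_inv_one_sub_le (hz' p hp)
    _ = Real.exp (∑ p ∈ P, ((g p * (p : ℂ) ^ (-s)).re + ‖g p * (p : ℂ) ^ (-s)‖ ^ 2)) := by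
        rw [Real.exp_sum]
    _ ≤ Real.exp (∑ p ∈ P, (g p * (p : ℂ) ^ (-s)).re + 1) := by
        apply Real.exp_le_exp.mpr
        rw [Finset.sum_add_distrib]
        gcongr
        calc ∑ p ∈ P, ‖g p * (p : ℂ) ^ (-s)‖ ^ 2 ≤ ∑ p ∈ P, (1 : ℝ) / (p : ℝ) ^ 2 := by
              refine Finset.sum_le_sum fun p hp => ?_
              calc ‖g p * (p : ℂ) ^ (-s)‖ ^ 2 ≤ (1 / p) ^ 2 := pow_le_pow_left₀ (norm_nonneg _) (hz p hp) 2
                _ = 1 / (p : ℝ) ^ 2 := by ring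
          _ ≤ ∑ p ∈ Nat.primesBelow (N + 1), (1 : ℝ) / (p : ℝ) ^ 2 :=
              Finset.sum_le_sum_of_subset_of_nonneg hP fun p _ _ => by positivity
          _ ≤ 1 := sum_primesBelow_inv_sq_le_one (N + 1)

/-- **A block factor minus one**: for a set `P` of primes and `Re s ≥ 1`, with
`z = ∑_{p ∈ P} g(p)p^{-s}`, `K = ∑_{p ∈ P} p^{-Re s}`, `ε = ∑_{p ∈ P} p^{-2}` (assumed `≤ 1`):
`‖∏_{p ∈ P} (1 - g(p)p^{-s})⁻¹ - 1‖ ≤ exp((K + Re z)/2 + 2ε)`.  Since `Re z = K - D` with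
`D = ∑_{p ∈ P} p^{-Re s}(1 - Re(g(p) p^{-i Im s}))` the block's pretentious distance, this says
`‖G_P - 1‖ ≤ e^{K - D/2 + 2ε}`: half of the distance is retained. [folklore] -/
theorem norm_blockEuler_sub_one_le (hgb : ∀ n, ‖g n‖ ≤ 1) {P : Finset ℕ} (hP : ∀ p ∈ P, p.Prime)
    {s : ℂ} (hs : 1 ≤ s.re) (hε : ∑ p ∈ P, (1 : ℝ) / (p : ℝ) ^ 2 ≤ 1) :
    ‖blockEuler g P s - 1‖ ≤
      Real.exp ((∑ p ∈ P, (p : ℝ) ^ (-s.re) + (∑ p ∈ P, g p * (p : ℂ) ^ (-s)).re) / 2 +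
        2 * ∑ p ∈ P, (1 : ℝ) / (p : ℝ) ^ 2) := by
  -- the Euler factor as an exponential
  set zp : ℕ → ℂ := fun p => g p * (p : ℂ) ^ (-s) with hzp
  have hz : ∀ p ∈ P, ‖zp p‖ ≤ 1 / p := fun p hp =>
    (norm_term_le_rpow hgb (hP p hp) s).trans (rpow_neg_re_le (hP p hp) hs)
  have hz' : ∀ p ∈ P, ‖zp p‖ ≤ 1 / 2 := fun p hp =>
    (hz p hp).trans (one_div_le_one_div_of_le (by norm_num) (by exact_mod_cast (hP p hp).two_le))
  have hne : ∀ p ∈ P, 1 - zp p ≠ 0 := by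
    intro p hp h
    have : ‖zp p‖ = 1 := by rw [show zp p = 1 by linear_combination -h]; simp
    linarith [hz' p hp]
  have hfac : ∀ p ∈ P, (1 - zp p)⁻¹ = Complex.exp (-Complex.log (1 - zp p)) := by
    intro p hp
    rw [Complex.exp_neg, Complex.exp_log (hne p hp)]
  have hprod : blockEuler g P s = Complex.exp (∑ p ∈ P, -Complex.log (1 - zp p)) := by
    unfold blockEuler
    rw [Complex.exp_sum]
    exact Finset.prod_congr rfl fun p hp => hfac p hp
  -- split `-log(1 - z_p) = z_p + r_p`
  set z : ℂ := ∑ p ∈ P, zp p with hzdef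
  set r : ℂ := ∑ p ∈ P, (-Complex.log (1 - zp p) - zp p) with hrdef
  have hsplit : ∑ p ∈ P, -Complex.log (1 - zp p) = z + r := by
    rw [hzdef, hrdef, ← Finset.sum_add_distrib]
    exact Finset.sum_congr rfl fun p _ => by ring
  have hrle : ‖r‖ ≤ ∑ p ∈ P, (1 : ℝ) / (p : ℝ) ^ 2 := by
    refine (norm_sum_le _ _).trans (Finset.sum_le_sum fun p hp => ?_)
    calc ‖-Complex.log (1 - zp p) - zp p‖ ≤ ‖zp p‖ ^ 2 := norm_neg_log_one_sub_sub_le (hz' p hp)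
      _ ≤ (1 / p) ^ 2 := pow_le_pow_left₀ (norm_nonneg _) (hz p hp) 2
      _ = 1 / (p : ℝ) ^ 2 := by ring
  have hr1 : ‖r‖ ≤ 1 := hrle.trans hε
  have hzK : ‖z‖ ≤ ∑ p ∈ P, (p : ℝ) ^ (-s.re) :=
    (norm_sum_le _ _).trans (Finset.sum_le_sum fun p hp => norm_term_le_rpow hgb (hP p hp) s)
  rw [hprod, hsplit]
  refine (norm_exp_add_sub_one_le hzK hr1).trans (Real.exp_le_exp.mpr ?_)
  have : z.re = (∑ p ∈ P, g p * (p : ℂ) ^ (-s)).re := rfl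
  rw [this]
  linarith

/-- `∑_{p ∈ P} 1/p² ≤ 1` for any set of primes `P ⊆` primes `≤ N`. [folklore] -/
theorem sum_inv_sq_le_one_of_subset {P : Finset ℕ} (hP : P ⊆ Nat.primesBelow (N + 1)) :
    ∑ p ∈ P, (1 : ℝ) / (p : ℝ) ^ 2 ≤ 1 :=
  (Finset.sum_le_sum_of_subset_of_nonneg hP fun p _ _ => by positivity).trans
    (sum_primesBelow_inv_sq_le_one (N + 1))

/-- **The product over the blocks**: for a block system and `Re s ≥ 1`,
`‖∏_{i ∈ 𝓙} (G_i(s) - 1)‖ ≤ exp(∑_{i ∈ 𝓙} (K_i + Re z_i)/2 + 2)`. [folklore] -/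
theorem norm_prod_blockEuler_sub_one_le [DecidableEq ι] (h : IsBlockSystem 𝓙 blk N)
    (hgb : ∀ n, ‖g n‖ ≤ 1) {s : ℂ} (hs : 1 ≤ s.re) :
    ‖∏ i ∈ 𝓙, (blockEuler g (blk i) s - 1)‖ ≤
      Real.exp (∑ i ∈ 𝓙, (∑ p ∈ blk i, (p : ℝ) ^ (-s.re) + (∑ p ∈ blk i, g p * (p : ℂ) ^ (-s)).re) / 2 + 2) := by
  rw [norm_prod]
  have hεi : ∀ i ∈ 𝓙, ∑ p ∈ blk i, (1 : ℝ) / (p : ℝ) ^ 2 ≤ 1 := fun i hi =>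
    sum_inv_sq_le_one_of_subset (h.subset i hi)
  calc ∏ i ∈ 𝓙, ‖blockEuler g (blk i) s - 1‖
      ≤ ∏ i ∈ 𝓙, Real.exp ((∑ p ∈ blk i, (p : ℝ) ^ (-s.re) + (∑ p ∈ blk i, g p * (p : ℂ) ^ (-s)).re) / 2 +
          2 * ∑ p ∈ blk i, (1 : ℝ) / (p : ℝ) ^ 2) :=
        Finset.prod_le_prod (fun i _ => norm_nonneg _) fun i hi =>
          norm_blockEuler_sub_one_le hgb (fun p hp => h.prime_of_mem hi hp) hs (hεi i hi)
    _ = Real.exp (∑ i ∈ 𝓙, ((∑ p ∈ blk i, (p : ℝ) ^ (-s.re) + (∑ p ∈ blk i, g p * (p : ℂ) ^ (-s)).re) / 2 +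
          2 * ∑ p ∈ blk i, (1 : ℝ) / (p : ℝ) ^ 2)) := by rw [Real.exp_sum]
    _ ≤ _ := by
        apply Real.exp_le_exp.mpr
        rw [Finset.sum_add_distrib, ← Finset.mul_sum]
        gcongr
        -- `∑_i ∑_{p ∈ blk i} 1/p² ≤ ∑_{p ≤ N} 1/p² ≤ 1` by disjointness
        have hU : ∑ i ∈ 𝓙, ∑ p ∈ blk i, (1 : ℝ) / (p : ℝ) ^ 2 = ∑ p ∈ 𝓙.biUnion blk, (1 : ℝ) / (p : ℝ) ^ 2 := by
          rw [Finset.sum_biUnion]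
          intro i hi j hj hij
          exact h.disjoint i hi j hj hij
        rw [hU]
        have := sum_inv_sq_le_one_of_subset (N := N) (h.biUnion_subset (t := 𝓙) le_rfl)
        linarith

/-- **Norm of the restricted series** on `Re s ≥ 1`:
`‖∑ a(n) n^{-s}‖ ≤ exp(3 + ∑_{p ≤ N, p ∉ E} Re(g(p)p^{-s}) + ∑_{i} (K_i + Re z_i)/2)`. [folklore] -/
theorem norm_LSeries_restr_le [DecidableEq ι] (h : IsBlockSystem 𝓙 blk N)
    (hg : ∀ m n, g (m * n) = g m * g n) (hg1 : g 1 = 1) (hgb : ∀ n, ‖g n‖ ≤ 1) {s : ℂ}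
    (hs : 1 ≤ s.re) :
    ‖LSeries (restr 𝓙 blk g N) s‖ ≤
      Real.exp (3 + ∑ p ∈ Nat.primesBelow (N + 1) \ 𝓙.biUnion blk, (g p * (p : ℂ) ^ (-s)).re +
        ∑ i ∈ 𝓙, (∑ p ∈ blk i, (p : ℝ) ^ (-s.re) + (∑ p ∈ blk i, g p * (p : ℂ) ^ (-s)).re) / 2) := by
  rw [(LSeries_restr_eq h hg hg1 hgb (by linarith)).2, norm_mul]
  have h1 := norm_blockEuler_le (N := N) hgb (P := Nat.primesBelow (N + 1) \ 𝓙.biUnion blk)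
    Finset.sdiff_subset hs
  have h2 := norm_prod_blockEuler_sub_one_le h hgb hs
  calc ‖blockEuler g (Nat.primesBelow (N + 1) \ 𝓙.biUnion blk) s‖ * ‖∏ i ∈ 𝓙, (blockEuler g (blk i) s - 1)‖
      ≤ Real.exp (∑ p ∈ Nat.primesBelow (N + 1) \ 𝓙.biUnion blk, (g p * (p : ℂ) ^ (-s)).re + 1) *
          Real.exp (∑ i ∈ 𝓙, (∑ p ∈ blk i, (p : ℝ) ^ (-s.re) + (∑ p ∈ blk i, g p * (p : ℂ) ^ (-s)).re) / 2 + 2) :=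
        mul_le_mul h1 h2 (norm_nonneg _) (Real.exp_pos _).le
    _ = _ := by rw [← Real.exp_add]; ring_nf

/-! ### The halved pretentious distance and the bound on the `1`-line -/

/-- The weight `w_p = 1/2` for `p ∈ E` and `1` otherwise. [folklore] -/
def halfWeight (E : Finset ℕ) (p : ℕ) : ℝ := if p ∈ E then 1 / 2 else 1

/-- **The halved distance** `𝔻_½(g, n^{iy}; x)² = ∑_{p ≤ x} w_p (1 - Re(g(p) p^{-iy}))/p`,
`w_p = 1/2` on `E`, `1` off `E` (cf. `Literature.NumberTheory.Sieve.pretentiousDistSq`, all weights `1`).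
[folklore] -/
def halfDistSq (E : Finset ℕ) (g : ℕ → ℂ) (y x : ℝ) : ℝ :=
  ∑ p ∈ Nat.primesLE ⌊x⌋₊, halfWeight E p * ((1 - (g p * conj ((p : ℂ) ^ ((y : ℂ) * I))).re) / p)

/-- `1/2 ≤ w_p ≤ 1`. [folklore] -/
theorem halfWeight_mem_Icc (E : Finset ℕ) (p : ℕ) : halfWeight E p ∈ Set.Icc (1 / 2 : ℝ) 1 := by
  unfold halfWeight; split_ifs <;> norm_num

/-- Each term `(1 - Re(g(p) conj(p^{iy})))/p` of the distance is nonnegative (`|g| ≤ 1`). [folklore] -/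
theorem term_nonneg (hgb : ∀ n, ‖g n‖ ≤ 1) (p : ℕ) (y : ℝ) :
    0 ≤ (1 - (g p * conj ((p : ℂ) ^ ((y : ℂ) * I))).re) / p := by
  refine div_nonneg ?_ (Nat.cast_nonneg p)
  have h1 : (g p * conj ((p : ℂ) ^ ((y : ℂ) * I))).re ≤ ‖g p * conj ((p : ℂ) ^ ((y : ℂ) * I))‖ :=
    Complex.re_le_norm _
  have h2 : ‖g p * conj ((p : ℂ) ^ ((y : ℂ) * I))‖ ≤ 1 := by
    rw [norm_mul, Complex.norm_conj]
    rcases Nat.eq_zero_or_pos p with rfl | hp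
    · rcases eq_or_ne ((y : ℂ) * I) 0 with h0 | h0
      · simp [h0]; exact hgb 0
      · simp [Complex.zero_cpow h0]
    · rw [Complex.norm_natCast_cpow_of_pos hp]
      simp only [Complex.mul_re, Complex.ofReal_re, Complex.I_re, mul_zero, Complex.ofReal_im,
        Complex.I_im, mul_one, sub_self, Real.rpow_zero, mul_one]
      exact hgb p
  linarith

/-- **`𝔻_½² ≥ 𝔻²/2`**: the halved distance is at least half the pretentious distance. [folklore] -/
theorem halfDistSq_ge_half (hgb : ∀ n, ‖g n‖ ≤ 1) (E : Finset ℕ) (y x : ℝ) :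
    Sieve.pretentiousDistSq g (fun n : ℕ => (n : ℂ) ^ ((y : ℂ) * I)) x / 2 ≤ halfDistSq E g y x := by
  unfold halfDistSq Sieve.pretentiousDistSq
  rw [Finset.sum_div]
  refine Finset.sum_le_sum fun p _ => ?_
  have ht := term_nonneg hgb p y
  have hw := (halfWeight_mem_Icc E p).1
  calc (1 - (g p * conj ((p : ℂ) ^ ((y : ℂ) * I))).re) / p / 2
      = 1 / 2 * ((1 - (g p * conj ((p : ℂ) ^ ((y : ℂ) * I))).re) / p) := by ring
    _ ≤ halfWeight E p * ((1 - (g p * conj ((p : ℂ) ^ ((y : ℂ) * I))).re) / p) :=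
        mul_le_mul_of_nonneg_right hw ht

/-- `𝔻_½² ≤ 𝔻²`. [folklore] -/
theorem halfDistSq_le (hgb : ∀ n, ‖g n‖ ≤ 1) (E : Finset ℕ) (y x : ℝ) :
    halfDistSq E g y x ≤ Sieve.pretentiousDistSq g (fun n : ℕ => (n : ℂ) ^ ((y : ℂ) * I)) x := by
  unfold halfDistSq Sieve.pretentiousDistSq
  refine Finset.sum_le_sum fun p _ => ?_
  have ht := term_nonneg hgb p y
  have hw := (halfWeight_mem_Icc E p).2
  exact mul_le_of_le_one_left ht hw

/-- `0 ≤ 𝔻_½²`. [folklore] -/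
theorem halfDistSq_nonneg (hgb : ∀ n, ‖g n‖ ≤ 1) (E : Finset ℕ) (y x : ℝ) : 0 ≤ halfDistSq E g y x := by
  have h := halfDistSq_ge_half hgb E y x
  have h0 : 0 ≤ Sieve.pretentiousDistSq g (fun n : ℕ => (n : ℂ) ^ ((y : ℂ) * I)) x := by
    refine Sieve.pretentiousDistSq_nonneg hgb (fun n => ?_) x
    rcases Nat.eq_zero_or_pos n with rfl | hn
    · rcases eq_or_ne ((y : ℂ) * I) 0 with h0 | h0
      · simp [h0]
      · simp [Complex.zero_cpow h0]
    · rw [Complex.norm_natCast_cpow_of_pos hn]; simp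
  linarith

variable {x : ℝ}

/-- **The exponent on the `1`-line**: with `N = ⌊x⌋`, `E = ⋃ blk i`,
`∑_{p ∉ E} Re(g(p)p^{-1-iy}) + ∑_i (K_i + Re z_i)/2 = ∑_{p ≤ N} 1/p - 𝔻_½(g, n^{iy}; x)²`. [folklore] -/
theorem exponent_one_line_eq [DecidableEq ι] (h : IsBlockSystem 𝓙 blk ⌊x⌋₊) (y : ℝ) :
    ∑ p ∈ Nat.primesBelow (⌊x⌋₊ + 1) \ 𝓙.biUnion blk, (g p * (p : ℂ) ^ (-((1 : ℂ) + y * I))).re +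
      ∑ i ∈ 𝓙, (∑ p ∈ blk i, (p : ℝ) ^ (-((1 : ℂ) + y * I).re) +
        (∑ p ∈ blk i, g p * (p : ℂ) ^ (-((1 : ℂ) + y * I))).re) / 2 =
      ∑ p ∈ Nat.primesLE ⌊x⌋₊, (1 : ℝ) / p - halfDistSq (𝓙.biUnion blk) g y x := by
  set E := 𝓙.biUnion blk with hE
  set Pr := Nat.primesLE ⌊x⌋₊ with hPr
  have hPB : Nat.primesBelow (⌊x⌋₊ + 1) = Pr := rfl
  have hEsub : E ⊆ Pr := hPB ▸ h.biUnion_subset (t := 𝓙) le_rfl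
  -- the per-prime quantity `u_p = 1/p - w_p (1 - Re(...))/p`
  set d : ℕ → ℝ := fun p => (1 - (g p * conj ((p : ℂ) ^ ((y : ℂ) * I))).re) / p with hd
  have hre : ∀ p : ℕ, 0 < p → (g p * (p : ℂ) ^ (-((1 : ℂ) + y * I))).re = 1 / p - d p := by
    intro p hp
    have := re_mul_cpow_neg_one_add (g p) hp y
    rw [show (-((1 : ℂ) + y * I)) = -(1 + (y : ℂ) * I) by rfl] at this ⊢
    rw [this, hd]
    field_simp
    ring
  have hres : ((1 : ℂ) + y * I).re = 1 := by simp
  -- right-hand side: split the sum over `Pr` into `Pr \ E` and `E`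
  have hsplit : ∑ p ∈ Pr, (1 : ℝ) / p - halfDistSq E g y x =
      ∑ p ∈ Pr \ E, ((1 : ℝ) / p - d p) + ∑ p ∈ E, ((1 : ℝ) / p - d p / 2) := by
    unfold halfDistSq
    rw [← hPr, ← Finset.sum_sub_distrib, ← Finset.sum_sdiff hEsub]
    congr 1
    · refine Finset.sum_congr rfl fun p hp => ?_
      rw [Finset.mem_sdiff] at hp
      simp only [halfWeight, if_neg hp.2, one_mul, hd]
    · refine Finset.sum_congr rfl fun p hp => ?_
      simp only [halfWeight, if_pos hp, hd]
      ring
  rw [hsplit]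
  congr 1
  · rw [hPB]
    refine Finset.sum_congr rfl fun p hp => ?_
    rw [Finset.mem_sdiff, hPr, Nat.mem_primesLE] at hp
    exact hre p hp.1.2.pos
  · rw [hE, Finset.sum_biUnion (fun i hi j hj hij => h.disjoint i hi j hj hij)]
    refine Finset.sum_congr rfl fun i hi => ?_
    rw [hres, Complex.re_sum, ← Finset.sum_add_distrib, Finset.sum_div]
    refine Finset.sum_congr rfl fun p hp => ?_
    have hpp := h.prime_of_mem hi hp
    rw [hre p hpp.pos, Real.rpow_neg (Nat.cast_nonneg p), Real.rpow_one, ← one_div]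
    ring

/-- **The restricted series on the `1`-line**: for `x ≥ 3` and a block system of primes `≤ ⌊x⌋`,
`‖∑ a(n) n^{-1-iy}‖ ≤ e⁷ log x · exp(-𝔻_½(g, n^{iy}; x)²)`. [folklore] -/
theorem norm_LSeries_restr_one_line_le [DecidableEq ι] (h : IsBlockSystem 𝓙 blk ⌊x⌋₊)
    (hg : ∀ m n, g (m * n) = g m * g n) (hg1 : g 1 = 1) (hgb : ∀ n, ‖g n‖ ≤ 1) (hx : 3 ≤ x)
    (y : ℝ) :
    ‖LSeries (restr 𝓙 blk g ⌊x⌋₊) (1 + y * I)‖ ≤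
      Real.exp 7 * Real.log x * Real.exp (-halfDistSq (𝓙.biUnion blk) g y x) := by
  have hL : 0 < Real.log x := Real.log_pos (by linarith)
  have hs : (1 : ℝ) ≤ ((1 : ℂ) + y * I).re := by simp
  have h1 := norm_LSeries_restr_le h hg hg1 hgb hs
  rw [add_assoc, exponent_one_line_eq h y] at h1
  refine h1.trans ?_
  have hM := sum_primesLE_inv_le hx
  calc Real.exp (3 + (∑ p ∈ Nat.primesLE ⌊x⌋₊, (1 : ℝ) / p - halfDistSq (𝓙.biUnion blk) g y x))
      ≤ Real.exp (3 + ((Real.log (Real.log x) + 4) - halfDistSq (𝓙.biUnion blk) g y x)) := by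
        apply Real.exp_le_exp.mpr; linarith
    _ = Real.exp 7 * Real.log x * Real.exp (-halfDistSq (𝓙.biUnion blk) g y x) := by
        rw [show 3 + (Real.log (Real.log x) + 4 - halfDistSq (𝓙.biUnion blk) g y x) =
          7 + Real.log (Real.log x) + -halfDistSq (𝓙.biUnion blk) g y x by ring,
          Real.exp_add, Real.exp_add, Real.exp_log hL]

/-- **The restricted series on `Re s = 1 + α`** (`0 < α ≤ 1`, `x ≥ 3`):
`‖∑ a(n) n^{-1-α-iy}‖ ≤ e^{12} min(log x, 1/α)`. [folklore] -/
theorem norm_LSeries_restr_le_min [DecidableEq ι] (h : IsBlockSystem 𝓙 blk ⌊x⌋₊)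
    (hg : ∀ m n, g (m * n) = g m * g n) (hg1 : g 1 = 1) (hgb : ∀ n, ‖g n‖ ≤ 1) (hx : 3 ≤ x)
    {α : ℝ} (hα : 0 < α) (hα1 : α ≤ 1) (y : ℝ) :
    ‖LSeries (restr 𝓙 blk g ⌊x⌋₊) (1 + α + y * I)‖ ≤ Real.exp 12 * min (Real.log x) (1 / α) := by
  have hL : 0 < Real.log x := Real.log_pos (by linarith)
  have hres : ((1 : ℂ) + α + y * I).re = 1 + α := by simp
  have hs : (1 : ℝ) ≤ ((1 : ℂ) + α + y * I).re := by rw [hres]; linarith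
  have h1 := norm_LSeries_restr_le h hg hg1 hgb hs
  refine h1.trans ?_
  set s : ℂ := (1 : ℂ) + α + y * I with hsdef
  set Pr := Nat.primesLE ⌊x⌋₊ with hPr
  have hPB : Nat.primesBelow (⌊x⌋₊ + 1) = Pr := rfl
  -- termwise: `Re(g(p)p^{-s}) ≤ p^{-1-α}` and the `K_i` terms are `p^{-1-α}`
  have hterm : ∀ p : ℕ, p.Prime → (g p * (p : ℂ) ^ (-s)).re ≤ (p : ℝ) ^ (-(1 + α)) := by
    intro p hp
    have := re_mul_cpow_le hgb hp.pos s
    rwa [hres] at this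
  have hexp : ∑ p ∈ Nat.primesBelow (⌊x⌋₊ + 1) \ 𝓙.biUnion blk, (g p * (p : ℂ) ^ (-s)).re +
      ∑ i ∈ 𝓙, (∑ p ∈ blk i, (p : ℝ) ^ (-s.re) + (∑ p ∈ blk i, g p * (p : ℂ) ^ (-s)).re) / 2 ≤
      ∑ p ∈ Pr, (p : ℝ) ^ (-(1 + α)) := by
    have hEsub : 𝓙.biUnion blk ⊆ Pr := hPB ▸ h.biUnion_subset (t := 𝓙) le_rfl
    rw [← Finset.sum_sdiff hEsub, hPB]
    gcongr with p hp
    · rw [Finset.mem_sdiff, hPr, Nat.mem_primesLE] at hp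
      exact hterm p hp.1.2
    · rw [Finset.sum_biUnion (fun i hi j hj hij => h.disjoint i hi j hj hij)]
      refine Finset.sum_le_sum fun i hi => ?_
      rw [hres, Complex.re_sum]
      have : ∑ p ∈ blk i, (g p * (p : ℂ) ^ (-s)).re ≤ ∑ p ∈ blk i, (p : ℝ) ^ (-(1 + α)) :=
        Finset.sum_le_sum fun p hp => hterm p (h.prime_of_mem hi hp)
      linarith
  have hPZ := sum_primesLE_rpow_le hα hα1 ⌊x⌋₊
  have hMert := sum_primesLE_inv_le hx
  have hle1 : ∑ p ∈ Pr, (p : ℝ) ^ (-(1 + α)) ≤ ∑ p ∈ Pr, (1 : ℝ) / p := by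
    refine Finset.sum_le_sum fun p hp => ?_
    rw [hPr, Nat.mem_primesLE] at hp
    have h2 : (p : ℝ) ^ (-(1 + α)) ≤ (p : ℝ) ^ (-1 : ℝ) :=
      Real.rpow_le_rpow_of_exponent_le (by exact_mod_cast hp.2.one_lt.le) (by linarith)
    rwa [Real.rpow_neg_one, ← one_div] at h2
  rcases le_total (Real.log x) (1 / α) with hmin | hmin
  · rw [min_eq_left hmin]
    calc Real.exp (3 + ∑ p ∈ Nat.primesBelow (⌊x⌋₊ + 1) \ 𝓙.biUnion blk, (g p * (p : ℂ) ^ (-s)).re +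
          ∑ i ∈ 𝓙, (∑ p ∈ blk i, (p : ℝ) ^ (-s.re) + (∑ p ∈ blk i, g p * (p : ℂ) ^ (-s)).re) / 2)
        ≤ Real.exp (3 + (Real.log (Real.log x) + 4)) := by
          apply Real.exp_le_exp.mpr
          rw [add_assoc]
          linarith
      _ = Real.exp 7 * Real.log x := by
          rw [show 3 + (Real.log (Real.log x) + 4) = 7 + Real.log (Real.log x) by ring, Real.exp_add,
            Real.exp_log hL]
      _ ≤ Real.exp 12 * Real.log x := by gcongr; norm_num
  · rw [min_eq_right hmin]
    calc Real.exp (3 + ∑ p ∈ Nat.primesBelow (⌊x⌋₊ + 1) \ 𝓙.biUnion blk, (g p * (p : ℂ) ^ (-s)).re +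
          ∑ i ∈ 𝓙, (∑ p ∈ blk i, (p : ℝ) ^ (-s.re) + (∑ p ∈ blk i, g p * (p : ℂ) ^ (-s)).re) / 2)
        ≤ Real.exp (3 + (Real.log (1 / α) + 9)) := by
          apply Real.exp_le_exp.mpr
          rw [add_assoc]
          linarith
      _ = Real.exp 12 * (1 / α) := by
          rw [show 3 + (Real.log (1 / α) + 9) = 12 + Real.log (1 / α) by ring, Real.exp_add,
            Real.exp_log (by positivity)]

/-! ### `ℓ¹` majorants of the restricted function -/

/-- `∑ ‖a(n)‖ n^{-σ} < ∞` for `σ > 0`. [folklore] -/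
theorem summable_norm_restr_div_rpow (hg : ∀ m n, g (m * n) = g m * g n) (hg1 : g 1 = 1)
    (hgb : ∀ n, ‖g n‖ ≤ 1) {σ : ℝ} (hσ : 0 < σ) :
    Summable fun n : ℕ => ‖restr 𝓙 blk g N n‖ / (n : ℝ) ^ σ := by
  have h := (LSeriesSummable_smoothCut (N := N) hg hg1 hgb (s := (σ : ℂ)) (by simpa using hσ)).norm
  have h' : Summable fun n : ℕ => ‖smoothCut g N n‖ / (n : ℝ) ^ σ := by
    refine h.congr fun n => ?_
    rcases Nat.eq_zero_or_pos n with rfl | hn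
    · simp [smoothCut_zero]
    · rw [LSeries.norm_term_eq, if_neg hn.ne', Complex.ofReal_re]
  refine Summable.of_nonneg_of_le (fun n => by positivity) (fun n => ?_) h'
  gcongr
  exact norm_restr_le_smoothCut n

/-- `∑ ‖a(n)‖/n ≤ e⁵ log x` (`x ≥ 3`, `N = ⌊x⌋`). [folklore] -/
theorem tsum_norm_restr_div_le (hg : ∀ m n, g (m * n) = g m * g n) (hg1 : g 1 = 1)
    (hgb : ∀ n, ‖g n‖ ≤ 1) (hx : 3 ≤ x) :
    ∑' n : ℕ, ‖restr 𝓙 blk g ⌊x⌋₊ n‖ / (n : ℝ) ^ (1 : ℝ) ≤ Real.exp 5 * Real.log x := by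
  obtain ⟨hsum, hle⟩ := tsum_norm_term_one_le (g := g) hgb hx
  refine le_trans (Summable.tsum_le_tsum (fun n => ?_)
    (summable_norm_restr_div_rpow hg hg1 hgb one_pos) hsum) hle
  gcongr
  exact norm_restr_le_smoothCut n

end Restricted

end Halasz

end Literature.NumberTheory.LFunctions
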